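import Summits.QuantumFields.BalabanUV.Beta.GAN24.SandwichReadoutSiteCharges
import Summits.QuantumFields.BalabanUV.Beta.GAN24.PiBmConstants

/-!
# `BalabanUV.Beta.GAN24.DressedStepFaceCharges` — binder row G-an2-4 ∕ (CONV-C), W-slot CT-W, conservation law (C)∕(C)sym, step (P5)(I) of this lineage's note
# `HOME/b2b-balaban-gan24-formalise-leaf-04/g65/CSYM-LEVEL0-KERNEL-BLUEPRINT.md`: **THE COARSE-LEG CHARGES OF A CO-DRESSED KERNEL `Πᵀ_bm K Π_bm` ARE THE EXIT-FACE
# PROFILES OF THE CHARGES OF `K`, AND THE TWO-FACE READ-OUT OF an2's `K3OfK` THROUGH THE DRESSED STEP KERNEL `unitK s_f s_m (coDressKBmAt ρ Lc (KInvStep Lc j))`**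
# — the dressed twin of leaf-06's `ExchangeReadout.hasSum_mmRead_K3OfK_unitKStep` (there: site-free charges `∓δ·σ_j`; here: `Lc·𝟙[exit face]·(∓δ·σ_j)`)

NOT IN PRINT; OUR BOOKKEEPING ([folklore] window bookkeeping BY NAME over an2's `AxialDressingRooted.piKBm ∕ pmBm ∕ cube ∕ coDressKBmAt ∕ comp_piKBm_inr ∕ tsum_window'`,
gan24-p4's `GAN24.PiBmConstants.sum_cube_sum_pmBm_row` (`Π_bm 1 = N·𝟙_{exit face}`), leaf-06's `GAN24.StepResolventLegCharges.hasSum_KInvStep_row ∕ _col ∕ hasSum_unitK_row ∕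
_col` ((Q-lin) ∕ (S2c) BY NAME) and the sibling `GAN24.SandwichReadoutSiteCharges`; G-an2-4 formalisation swarm, leaf prover `b2b-balaban-gan24-formalise-leaf-04`, gen 65).
HONEST FRAMING (cell contract, verbatim): «discharging `BetaPertH` makes Bałaban's UV stability UNCONDITIONAL — a real constructive-QFT result; it is NOT the continuum
limit and NOT the Clay problem.»  HONEST DEPENDENCY (verbatim): «continuum YM on T⁴ ⇐ BetaPertH ∧ nine spine estimates (0/9 proved); BetaPertH ⇐ (D1) ∧ (D4) ∧
CAP+tail; G-an2-4 gates asym, D1 and NE2/3/4.»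

WHY (blueprint §1 (I)–(II); note g64 §3: «`G m_β = Π K m_β = (s·L·𝟙_{F_β}, 0)`»): in the dressed one-step zero mode the outer multiplier legs of the source read the
dressed kernel's coarse-leg charges, which are NOT site-free: `Π_bm` does not fix constants but returns `Lc` times the exit-face indicator.  With these charges the
ff zero-mode channels of the dressed source are TWO-FACE double-leg sums (`Σ'_{(y,w)} [y_α ≡ −1][w_β ≡ −1]·V y w (inl α)(inl β)`, residues mod `Lc`) of the two
exchange words `(dM_b∘X♮)∘dM_{b′}` and of `W_{bb′}` — the face-weighted contractions behind the edge currents of `GAN24.WilsonEdgeCurrent` (blueprint (II)).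

WHAT ([folklore]; generic `d`; 0 `def`, 0 cited facts, 0 `def … : Prop`, 0 sorry): §3 `comp_trK_piKBm_inr` (`Πᵀ` does not touch a multiplier row), **`coDressKBmAt_inr_inl`** ∕
**`coDressKBmAt_inl_inr`** (window forms of the multiplier–field rows ∕ field–multiplier columns of `Πᵀ K Π`), **`hasSum_coDressKBmAt_row ∕ _col`** (in-block root `ρ = toSite r`,
`1 ≤ N`: site-free charges `ρ` of `K` vanishing on multiplier legs ⇒ charges `inl a ↦ [y_a % N = N−1]·N·ρ (inl a)`, `inr ↦ 0` of `Πᵀ_bm K Π_bm`); §4 `sum_elim_face_charges`,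
**`hasSum_dressedStep_row ∕ _col`** (the charges of `unitK s_f s_m (coDressKBmAt (toSite r) Lc (KInvStep Lc j))`: `[face]·Lc·(∓δ·σ_j)·s_f s_m`, `σ_j = (Lc^{j+1})^{−(d+2)}`),
**`hasSum_mmRead_K3OfK_dressedStep`** (the ff block of `mmRead Lc (K3OfK X̃♮_j Lc S M W b b′)` has the `HasSum` `−(s_f s_m σ_j)²·Lc²·(FF[(dM_b∘X̃♮_j)∘dM_{b′}] + FF[(dM_{b′}∘X̃♮_j)∘dM_b]
− FF[W_{bb′}])`, `FF[V] := Σ'_{(y,w)} [y_α face][w_β face]·V y w (inl α)(inl β)` — every level `j`, all units, localised `dM ∕ W`).  Asserts NO value of Bałaban's tables;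
discharges NOTHING of (C)sym ∕ (Q-D) ∕ (Q-D-rate) ∕ «T2Shape» ∕ «T2Drift» ∕ (hW, hWall); NEVER «G-an2-4 closed» as (CONV-C); NOT D1, NOT `BetaPertH`, NOT continuum, NOT Clay.
2026-08-22; no existing file touched.
-/

noncomputable section

open Finset
open scoped BigOperators
open Literature.MathematicalPhysics.QuantumFieldTheory
open Literature.MathematicalPhysics.QuantumFieldTheory.Balaban1983to89
open Literature.MathematicalPhysics.QuantumFieldTheory.Balaban1983to89.Beta
open ExpKernelCalculus (Site MKer BiLoc Decays comp)
open OneStepResolventKernel (Fib)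
open OneStepKernelFamily (KInvStep decays_KInvStep)
open SecondOrderResponse (dM)
open BalabanStepW2 (K3OfK)
open BalabanStepJetsSucc (mmRead)
open AffineAveraging (box toSite)
open Summit.QuantumFields.BalabanUV.Beta.TameKernelCalculus (Loc trK)
open Summit.QuantumFields.BalabanUV.Beta.AxialDressingRooted (piKBm pmBm cube coDressKBmAt coDressKBmAt_eq comp_piKBm_inr piKBm_inl_inl piKBm_inl_inr
  piKBm_inr_inl piKBm_inr_inr sum_piKBm_col_inl tsum_window' tsum_point' decays_coDressKBmAt)
open Summit.QuantumFields.BalabanUV.Beta.HessKerDressedUnits (unitK unitK_apply legScale legScale_inl legScale_inr decays_unitK)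
open Summit.QuantumFields.BalabanUV.Beta.GAN24.PiBmConstants (sum_cube_sum_pmBm_row)
open Summit.QuantumFields.BalabanUV.Beta.GAN24.StepResolventLegCharges (hasSum_KInvStep_row hasSum_KInvStep_col hasSum_unitK_row hasSum_unitK_col)
open Summit.QuantumFields.BalabanUV.Beta.GAN24.SandwichReadoutSiteCharges (hasSum_mmRead_K3OfK_site)

namespace Summit.QuantumFields.BalabanUV.Beta.GAN24.DressedStepFaceCharges

variable {d : ℕ} {N : ℕ} [NeZero N]

/-! ## §3 (numbering continues the sibling `SandwichReadoutSiteCharges` §1–§2) The coarse-leg charges of a co-dressed kernel `Πᵀ_bm K Π_bm` are the exit-face profiles of the charges of `K` -/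

section CoDress

variable (ρ : Fin (d + 1) → ℤ)

omit [NeZero N] in
/-- [folklore] Left composition with `Πᵀ = trK (piKBm ρ N)` does not touch a multiplier ROW. -/
theorem comp_trK_piKBm_inr (A : MKer (d + 1) (Fib d)) (x y : Site (d + 1)) (μ : Fin (d + 1)) (b : Fib d) :
    comp (trK (piKBm ρ N)) A x y (Sum.inr μ) b = A x y (Sum.inr μ) b := by
  unfold ExpKernelCalculus.comp
  have h : ∀ u, ∑ g : Fib d, trK (piKBm ρ N) x u (Sum.inr μ) g * A u y g b = if u = x then A u y (Sum.inr μ) b else 0 := by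
    intro u
    rw [Fintype.sum_sum_type]
    simp only [trK, piKBm_inl_inr, zero_mul, Finset.sum_const_zero, zero_add, piKBm_inr_inr]
    by_cases hu : u = x
    · subst hu
      simp only [true_and, ite_mul, one_mul, zero_mul, Finset.sum_ite_eq', Finset.mem_univ, if_true]
    · simp [hu]
  simp_rw [h]
  exact tsum_point' x (fun u => A u y (Sum.inr μ) b)

omit [NeZero N] in
/-- [folklore] **THE MULTIPLIER–FIELD ROWS OF THE CO-DRESSED KERNEL, WINDOW FORM**: `(Πᵀ K Π) x y (inr α) (inl a) = Σ_{v ∈ cube} Σ_κ K x (y − v) (inr α) (inl κ) ·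
pmBm ρ N a y κ (y − v)`. -/
theorem coDressKBmAt_inr_inl (K : MKer (d + 1) (Fib d)) (x y : Site (d + 1)) (α a : Fin (d + 1)) :
    coDressKBmAt ρ N K x y (Sum.inr α) (Sum.inl a) =
      ∑ v ∈ cube (d + 1) N, ∑ κ : Fin (d + 1), K x (y - v) (Sum.inr α) (Sum.inl κ) * pmBm ρ N a y κ (y - v) := by
  rw [coDressKBmAt_eq]
  unfold ExpKernelCalculus.comp
  have h : ∀ u, ∑ g : Fib d, (∑' u0, ∑ g0 : Fib d, trK (piKBm ρ N) x u0 (Sum.inr α) g0 * K u0 u g0 g) * piKBm ρ N u y g (Sum.inl a) =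
      if y - u ∈ cube (d + 1) N then ∑ κ : Fin (d + 1), K x u (Sum.inr α) (Sum.inl κ) * pmBm ρ N a y κ u else 0 := by
    intro u
    have e : ∀ g : Fib d, (∑' u0, ∑ g0 : Fib d, trK (piKBm ρ N) x u0 (Sum.inr α) g0 * K u0 u g0 g) = K x u (Sum.inr α) g := fun g =>
      comp_trK_piKBm_inr (N := N) ρ K x u α g
    simp_rw [e]
    rw [Fintype.sum_sum_type]
    simp only [piKBm_inl_inl, piKBm_inr_inl, mul_zero, Finset.sum_const_zero, add_zero]
    split_ifs with hw
    · exact Finset.sum_congr rfl fun κ _ => by ring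
    · simp
  simp_rw [h]
  rw [tsum_window']

omit [NeZero N] in
/-- [folklore] **THE FIELD–MULTIPLIER COLUMNS OF THE CO-DRESSED KERNEL, WINDOW FORM**: `(Πᵀ K Π) w z (inl b) (inr β) = Σ_{v ∈ cube} Σ_κ pmBm ρ N b w κ (w − v) ·
K (w − v) z (inl κ) (inr β)`. -/
theorem coDressKBmAt_inl_inr (K : MKer (d + 1) (Fib d)) (w z : Site (d + 1)) (b β : Fin (d + 1)) :
    coDressKBmAt ρ N K w z (Sum.inl b) (Sum.inr β) =
      ∑ v ∈ cube (d + 1) N, ∑ κ : Fin (d + 1), pmBm ρ N b w κ (w - v) * K (w - v) z (Sum.inl κ) (Sum.inr β) := by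
  rw [coDressKBmAt_eq, comp_piKBm_inr]
  unfold ExpKernelCalculus.comp
  simp only [trK]
  have h : ∀ u, ∑ f : Fib d, piKBm ρ N u w f (Sum.inl b) * K u z f (Sum.inr β) =
      if w - u ∈ cube (d + 1) N then ∑ κ : Fin (d + 1), pmBm ρ N b w κ u * K u z (Sum.inl κ) (Sum.inr β) else 0 := fun u =>
    sum_piKBm_col_inl ρ N u w b (fun f => K u z f (Sum.inr β))
  simp_rw [h]
  rw [tsum_window']

variable {ρ}
variable {r : Fin (d + 1) → ℕ}

omit [NeZero N] in
/-- [folklore] **THE ROW CHARGES OF A CO-DRESSED KERNEL ARE THE EXIT-FACE PROFILES OF THE ROW CHARGES OF `K`** (in-block root `ρ = toSite r`, `1 ≤ N`): if the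
coarse-leg rows of `K` against `inr α` have site-free charges `ρL` vanishing on multiplier legs, then those of `Πᵀ_bm K Π_bm` have the charges
`inl a ↦ [y_a % N = N−1]·N·ρL (inl a)`, `inr m ↦ 0` (`PiBmConstants.sum_cube_sum_pmBm_row`: `Π_bm 1 = N·𝟙_{exit face}`). -/
theorem hasSum_coDressKBmAt_row (hN : 1 ≤ N) (hr : r ∈ box (d + 1) N) {K : MKer (d + 1) (Fib d)} (α : Fin (d + 1)) {ρL : Fib d → ℝ}
    (hrow : ∀ f y, HasSum (fun x' : Site (d + 1) => K ((N : ℤ) • x') y (Sum.inr α) f) (ρL f)) (hm : ∀ m, ρL (Sum.inr m) = 0) (f : Fib d)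
    (y : Site (d + 1)) :
    HasSum (fun x' : Site (d + 1) => coDressKBmAt (toSite r) N K ((N : ℤ) • x') y (Sum.inr α) f)
      (Sum.elim (fun a => if y a % (N : ℤ) = (N : ℤ) - 1 then (N : ℝ) * ρL (Sum.inl a) else 0) (fun _ => (0 : ℝ)) f) := by
  rcases f with a | m
  · simp_rw [coDressKBmAt_inr_inl]
    have h := hasSum_sum (s := cube (d + 1) N) fun v _ => hasSum_sum (s := (Finset.univ : Finset (Fin (d + 1)))) fun κ _ =>
      (hrow (Sum.inl κ) (y - v)).mul_right (pmBm (toSite r) N a y κ (y - v))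
    simp only [Sum.elim_inl]
    rw [show (∑ v ∈ cube (d + 1) N, ∑ κ : Fin (d + 1), ρL (Sum.inl κ) * pmBm (toSite r) N a y κ (y - v)) =
        ∑ v ∈ cube (d + 1) N, ∑ κ : Fin (d + 1), pmBm (toSite r) N a y κ (y - v) * ρL (Sum.inl κ) from
        Finset.sum_congr rfl fun v _ => Finset.sum_congr rfl fun κ _ => mul_comm _ _,
      sum_cube_sum_pmBm_row hN hr (fun κ => ρL (Sum.inl κ)) a y] at h
    exact h
  · simp only [Sum.elim_inr]
    have e : ∀ x' : Site (d + 1), coDressKBmAt (toSite r) N K ((N : ℤ) • x') y (Sum.inr α) (Sum.inr m) = K ((N : ℤ) • x') y (Sum.inr α) (Sum.inr m) := by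
      intro x'
      rw [coDressKBmAt_eq, comp_piKBm_inr, comp_trK_piKBm_inr]
    simp_rw [e]
    have h := hrow (Sum.inr m) y
    rwa [hm] at h

omit [NeZero N] in
/-- [folklore] **THE COLUMN CHARGES OF A CO-DRESSED KERNEL ARE THE EXIT-FACE PROFILES OF THE COLUMN CHARGES OF `K`** (in-block root, `1 ≤ N`). -/
theorem hasSum_coDressKBmAt_col (hN : 1 ≤ N) (hr : r ∈ box (d + 1) N) {K : MKer (d + 1) (Fib d)} (β : Fin (d + 1)) {ρR : Fib d → ℝ}
    (hcol : ∀ g w, HasSum (fun z' : Site (d + 1) => K w ((N : ℤ) • z') g (Sum.inr β)) (ρR g)) (hm : ∀ m, ρR (Sum.inr m) = 0) (g : Fib d)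
    (w : Site (d + 1)) :
    HasSum (fun z' : Site (d + 1) => coDressKBmAt (toSite r) N K w ((N : ℤ) • z') g (Sum.inr β))
      (Sum.elim (fun b => if w b % (N : ℤ) = (N : ℤ) - 1 then (N : ℝ) * ρR (Sum.inl b) else 0) (fun _ => (0 : ℝ)) g) := by
  rcases g with b | m
  · simp_rw [coDressKBmAt_inl_inr]
    have h := hasSum_sum (s := cube (d + 1) N) fun v _ => hasSum_sum (s := (Finset.univ : Finset (Fin (d + 1)))) fun κ _ =>
      (hcol (Sum.inl κ) (w - v)).mul_left (pmBm (toSite r) N b w κ (w - v))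
    simp only [Sum.elim_inl]
    rw [sum_cube_sum_pmBm_row hN hr (fun κ => ρR (Sum.inl κ)) b w] at h
    exact h
  · simp only [Sum.elim_inr]
    have e : ∀ z' : Site (d + 1), coDressKBmAt (toSite r) N K w ((N : ℤ) • z') (Sum.inr m) (Sum.inr β) = K w ((N : ℤ) • z') (Sum.inr m) (Sum.inr β) := by
      intro z'
      rw [coDressKBmAt_eq, comp_piKBm_inr, comp_trK_piKBm_inr]
    simp_rw [e]
    have h := hcol (Sum.inr m) w
    rwa [hm] at h

end CoDress

/-! ## §4 The W-slot instance: the dressed step kernel `unitK s_f s_m (coDressKBmAt ρ Lc (KInvStep Lc j))` at blocking `Lc` — TWO-FACE read-out -/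

section Step

variable {Lc : ℕ} [NeZero Lc] {r : Fin (d + 1) → ℕ}

/-- [folklore] The fibre bookkeeping of the read-out value at FACE-PROFILE charges: with row charges `−[y_a face]·c·δ_{aα}·s` ∕ `0` and column charges
`+[w_b face]·c·δ_{bβ}·t` ∕ `0`, `Σ_{f,g} ρL f y · V f g · ρR g w = −(s·t)·c²·[y_α face]·[w_β face]·V (inl α) (inl β)`. -/
theorem sum_elim_face_charges (V : Fib d → Fib d → ℝ) (α β : Fin (d + 1)) (s t c : ℝ) (P Q : Fin (d + 1) → Prop) [DecidablePred P]
    [DecidablePred Q] :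
    ∑ f, ∑ g, Sum.elim (fun a => if P a then c * -(if a = α then s else 0) else 0) (fun _ => (0 : ℝ)) f * V f g *
        Sum.elim (fun b => if Q b then c * (if b = β then t else 0) else 0) (fun _ => (0 : ℝ)) g =
      -(s * t) * (c * c) * ((if P α then 1 else 0) * (if Q β then 1 else 0) * V (Sum.inl α) (Sum.inl β)) := by
  rw [Fintype.sum_sum_type]
  have hr : ∑ m : Fin (d + 1), ∑ g, Sum.elim (fun a => if P a then c * -(if a = α then s else 0) else 0) (fun _ => (0 : ℝ)) (Sum.inr m : Fib d) *
      V (Sum.inr m) g * Sum.elim (fun b => if Q b then c * (if b = β then t else 0) else 0) (fun _ => (0 : ℝ)) g = 0 :=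
    Finset.sum_eq_zero fun m _ => Finset.sum_eq_zero fun g _ => by simp only [Sum.elim_inr, zero_mul]
  rw [hr, add_zero]
  have hl : ∀ a : Fin (d + 1), ∑ g, Sum.elim (fun a => if P a then c * -(if a = α then s else 0) else 0) (fun _ => (0 : ℝ)) (Sum.inl a : Fib d) *
      V (Sum.inl a) g * Sum.elim (fun b => if Q b then c * (if b = β then t else 0) else 0) (fun _ => (0 : ℝ)) g =
      (if P a then c * -(if a = α then s else 0) else 0) * V (Sum.inl a) (Sum.inl β) * (if Q β then c * t else 0) := by
    intro a
    rw [Fintype.sum_sum_type]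
    have h2 : ∑ m : Fin (d + 1), Sum.elim (fun a => if P a then c * -(if a = α then s else 0) else 0) (fun _ => (0 : ℝ)) (Sum.inl a : Fib d) *
        V (Sum.inl a) (Sum.inr m) * Sum.elim (fun b => if Q b then c * (if b = β then t else 0) else 0) (fun _ => (0 : ℝ)) (Sum.inr m : Fib d) = 0 :=
      Finset.sum_eq_zero fun m _ => by simp only [Sum.elim_inr, mul_zero]
    rw [h2, add_zero, Finset.sum_eq_single β]
    · simp only [Sum.elim_inl, if_true]
    · intro b _ hb
      simp only [Sum.elim_inl, if_neg hb, mul_zero, ite_self]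
    · intro hβ
      exact absurd (Finset.mem_univ β) hβ
  simp_rw [hl]
  rw [Finset.sum_eq_single α]
  · simp only [if_true]
    split_ifs <;> ring
  · intro a _ ha
    simp only [if_neg ha, neg_zero, mul_zero, ite_self, zero_mul]
  · intro hα
    exact absurd (Finset.mem_univ α) hα

/-- [folklore] **THE ROW CHARGES OF THE DRESSED STEP KERNEL** `K̃♮_j = unitK s_f s_m (coDressKBmAt ρ Lc (KInvStep Lc j))` (in-block root `ρ = toSite r`, `1 ≤ Lc`): against
`inr α`, field leg `inl a` at `y` ↦ `[y_a % Lc = Lc − 1]·Lc·(−δ_{aα}·σ_j)·s_m·s_f`, multiplier legs ↦ `0` (`σ_j = (Lc^{j+1})^{−(d+2)}`) — the exit-FACE profile of the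
undressed site-free charge (`StepResolventLegCharges.hasSum_KInvStep_row`, §3). -/
theorem hasSum_dressedStep_row (hLc : 1 ≤ Lc) (hr : r ∈ box (d + 1) Lc) (sf sm : ℝ) (j : ℕ) (α : Fin (d + 1)) (f : Fib d) (y : Site (d + 1)) :
    HasSum (fun x' : Site (d + 1) => unitK sf sm (coDressKBmAt (toSite r) Lc (KInvStep (d := d) Lc j)) (((Lc : ℕ) : ℤ) • x') y (Sum.inr α) f)
      (Sum.elim (fun a => if y a % (Lc : ℤ) = (Lc : ℤ) - 1 then ((Lc : ℝ) * (sm * sf)) *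
          -(if a = α then ((((Lc ^ (j + 1) : ℕ) : ℝ)) ^ (d + 1 + 1))⁻¹ else 0) else 0) (fun _ => (0 : ℝ)) f) := by
  have h0 := hasSum_coDressKBmAt_row (N := Lc) hLc hr (K := KInvStep (d := d) Lc j) α
    (ρL := Sum.elim (fun a => -(if a = α then ((((Lc ^ (j + 1) : ℕ) : ℝ)) ^ (d + 1 + 1))⁻¹ else 0)) (fun _ => (0 : ℝ)))
    (fun f y => hasSum_KInvStep_row (d := d) (Lc := Lc) j α f y) (fun _ => rfl) f y
  have h := hasSum_unitK_row sf sm h0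
  rcases f with a | m
  · simp only [Sum.elim_inl, legScale_inl] at h ⊢
    convert h using 1
    split_ifs <;> ring
  · simp only [Sum.elim_inr, legScale_inr, mul_zero, zero_mul] at h ⊢
    exact h

/-- [folklore] **THE COLUMN CHARGES OF THE DRESSED STEP KERNEL**: against `inr β`, field leg `inl b` at `w` ↦ `[w_b % Lc = Lc − 1]·Lc·(δ_{bβ}·σ_j)·s_f·s_m`, multiplier legs ↦ `0`. -/
theorem hasSum_dressedStep_col (hLc : 1 ≤ Lc) (hr : r ∈ box (d + 1) Lc) (sf sm : ℝ) (j : ℕ) (β : Fin (d + 1)) (g : Fib d) (w : Site (d + 1)) :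
    HasSum (fun z' : Site (d + 1) => unitK sf sm (coDressKBmAt (toSite r) Lc (KInvStep (d := d) Lc j)) w (((Lc : ℕ) : ℤ) • z') g (Sum.inr β))
      (Sum.elim (fun b => if w b % (Lc : ℤ) = (Lc : ℤ) - 1 then ((Lc : ℝ) * (sm * sf)) *
          (if b = β then ((((Lc ^ (j + 1) : ℕ) : ℝ)) ^ (d + 1 + 1))⁻¹ else 0) else 0) (fun _ => (0 : ℝ)) g) := by
  have h0 := hasSum_coDressKBmAt_col (N := Lc) hLc hr (K := KInvStep (d := d) Lc j) β
    (ρR := Sum.elim (fun b => if b = β then ((((Lc ^ (j + 1) : ℕ) : ℝ)) ^ (d + 1 + 1))⁻¹ else 0) (fun _ => (0 : ℝ)))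
    (fun g w => hasSum_KInvStep_col (d := d) (Lc := Lc) j β g w) (fun _ => rfl) g w
  have h := hasSum_unitK_col sf sm h0
  rcases g with b | m
  · simp only [Sum.elim_inl, legScale_inl] at h ⊢
    convert h using 1
    split_ifs <;> ring
  · simp only [Sum.elim_inr, legScale_inr, mul_zero, zero_mul] at h ⊢
    exact h

/-- [folklore] **THE TWO-FACE READ-OUT OF an2's `K3OfK` THROUGH THE DRESSED STEP KERNEL** (in-block root, `1 ≤ Lc`, every level `j`, all units): for
`K̃♮_j = unitK s_f s_m (coDressKBmAt ρ Lc (KInvStep Lc j))`, localised `dM_b ∕ dM_{b′} ∕ W_{bb′}`, the field–field block of `mmRead Lc (K3OfK K̃♮_j Lc S M W b b′)` has the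
double-leg `HasSum` `−(s_f·s_m·σ_j)²·Lc²·( Σ'_{(y,w)} [y_α ∕ w_β at exit faces]·((dM_b∘K̃♮_j)∘dM_{b′}) y w (inl α)(inl β) + (b ↔ b′) − Σ'_{(y,w)} [faces]·W_{bb′} y w (inl α)(inl β) )`
— the dressed twin of leaf-06's `ExchangeReadout.hasSum_mmRead_K3OfK_unitKStep`: the site-free charges become exit-FACE indicators (times `Lc`). -/
theorem hasSum_mmRead_K3OfK_dressedStep (hLc : 1 ≤ Lc) (hr : r ∈ box (d + 1) Lc) (sf sm : ℝ) (j : ℕ)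
    {S M : Fin (d + 1) → Site (d + 1) → MKer (d + 1) (Fib d)}
    {W : Fin (d + 1) → Site (d + 1) → Fin (d + 1) → Site (d + 1) → MKer (d + 1) (Fib d)} {μ ν : Fin (d + 1)} {y y' : Site (d + 1)}
    (hb : Loc (dM (unitK sf sm (coDressKBmAt (toSite r) Lc (KInvStep (d := d) Lc j))) Lc S M μ y))
    (hb' : Loc (dM (unitK sf sm (coDressKBmAt (toSite r) Lc (KInvStep (d := d) Lc j))) Lc S M ν y'))
    (hW : Loc (W μ y ν y')) (α β : Fin (d + 1)) :
    HasSum (fun xz : Site (d + 1) × Site (d + 1) =>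
        mmRead Lc (K3OfK (unitK sf sm (coDressKBmAt (toSite r) Lc (KInvStep (d := d) Lc j))) Lc S M W μ y ν y') xz.1 xz.2 (Sum.inl α) (Sum.inl β))
      (-((sf * sm * ((((Lc ^ (j + 1) : ℕ) : ℝ)) ^ (d + 1 + 1))⁻¹) * (sf * sm * ((((Lc ^ (j + 1) : ℕ) : ℝ)) ^ (d + 1 + 1))⁻¹)) * ((Lc : ℝ) * (Lc : ℝ)) *
        ((∑' yw : Site (d + 1) × Site (d + 1),
            (if yw.1 α % (Lc : ℤ) = (Lc : ℤ) - 1 then (1 : ℝ) else 0) * (if yw.2 β % (Lc : ℤ) = (Lc : ℤ) - 1 then (1 : ℝ) else 0) *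
            comp (comp (dM (unitK sf sm (coDressKBmAt (toSite r) Lc (KInvStep (d := d) Lc j))) Lc S M μ y)
              (unitK sf sm (coDressKBmAt (toSite r) Lc (KInvStep (d := d) Lc j))))
              (dM (unitK sf sm (coDressKBmAt (toSite r) Lc (KInvStep (d := d) Lc j))) Lc S M ν y') yw.1 yw.2 (Sum.inl α) (Sum.inl β)) +
          (∑' yw : Site (d + 1) × Site (d + 1),
            (if yw.1 α % (Lc : ℤ) = (Lc : ℤ) - 1 then (1 : ℝ) else 0) * (if yw.2 β % (Lc : ℤ) = (Lc : ℤ) - 1 then (1 : ℝ) else 0) *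
            comp (comp (dM (unitK sf sm (coDressKBmAt (toSite r) Lc (KInvStep (d := d) Lc j))) Lc S M ν y')
              (unitK sf sm (coDressKBmAt (toSite r) Lc (KInvStep (d := d) Lc j))))
              (dM (unitK sf sm (coDressKBmAt (toSite r) Lc (KInvStep (d := d) Lc j))) Lc S M μ y) yw.1 yw.2 (Sum.inl α) (Sum.inl β)) -
          ∑' yw : Site (d + 1) × Site (d + 1),
            (if yw.1 α % (Lc : ℤ) = (Lc : ℤ) - 1 then (1 : ℝ) else 0) * (if yw.2 β % (Lc : ℤ) = (Lc : ℤ) - 1 then (1 : ℝ) else 0) *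
            W μ y ν y' yw.1 yw.2 (Sum.inl α) (Sum.inl β))) := by
  obtain ⟨δ, C', hδ, -, hK'⟩ := decays_coDressKBmAt hLc hr (decays_KInvStep (d := d) (Lc := Lc) j)
  have hKu : Decays (unitK sf sm (coDressKBmAt (toSite r) Lc (KInvStep (d := d) Lc j))) (max |sf| |sm| * C' * max |sf| |sm|) δ := decays_unitK hK'
  have hrow := fun f w => hasSum_dressedStep_row (d := d) hLc hr sf sm j α f w
  have hcol := fun g w => hasSum_dressedStep_col (d := d) hLc hr sf sm j β g w
  have h := hasSum_mmRead_K3OfK_site (N := Lc) hKu hδ hb hb' hW α β hrow hcol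
  have hfib : ∀ (V : Fib d → Fib d → ℝ) (yy ww : Site (d + 1)),
      ∑ f, ∑ g, Sum.elim (fun a => if yy a % (Lc : ℤ) = (Lc : ℤ) - 1 then ((Lc : ℝ) * (sm * sf)) *
          -(if a = α then ((((Lc ^ (j + 1) : ℕ) : ℝ)) ^ (d + 1 + 1))⁻¹ else 0) else 0) (fun _ => (0 : ℝ)) f * V f g *
        Sum.elim (fun b => if ww b % (Lc : ℤ) = (Lc : ℤ) - 1 then ((Lc : ℝ) * (sm * sf)) *
          (if b = β then ((((Lc ^ (j + 1) : ℕ) : ℝ)) ^ (d + 1 + 1))⁻¹ else 0) else 0) (fun _ => (0 : ℝ)) g =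
      -(((((Lc ^ (j + 1) : ℕ) : ℝ)) ^ (d + 1 + 1))⁻¹ * ((((Lc ^ (j + 1) : ℕ) : ℝ)) ^ (d + 1 + 1))⁻¹) * (((Lc : ℝ) * (sm * sf)) * ((Lc : ℝ) * (sm * sf))) *
        ((if yy α % (Lc : ℤ) = (Lc : ℤ) - 1 then (1 : ℝ) else 0) * (if ww β % (Lc : ℤ) = (Lc : ℤ) - 1 then (1 : ℝ) else 0) * V (Sum.inl α) (Sum.inl β)) :=
    fun V yy ww => sum_elim_face_charges V α β _ _ ((Lc : ℝ) * (sm * sf)) (fun a => yy a % (Lc : ℤ) = (Lc : ℤ) - 1) (fun b => ww b % (Lc : ℤ) = (Lc : ℤ) - 1)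
  simp only [hfib] at h
  rw [tsum_mul_left, tsum_mul_left, tsum_mul_left] at h
  convert h using 1
  ring

end Step

end Summit.QuantumFields.BalabanUV.Beta.GAN24.DressedStepFaceCharges

end
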